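import Summits.CriticalPhenomena.PercolationContinuityZ3.Theorems.PercNearOneGluingNoHeavyLowerTailSunflowerLeafLeafTwoLevel
import HarnessLib

/-!
# `NoHeavyLowerTail` (crux stmt-CriticalPhenomena-4575), abstract sunflower cubic: THE EDGE DECOMPOSITION OF LEMMA A
# (Lemma A for `A₀ ∪ [ab] ∪ [ac] ∪ [bd]` — an edge `ab` whose endpoints carry one more neighbour each — from a three-number
# cell inequality `EdgeLemma` whose inputs are plain safeties and two TWO-LEVEL Lemma A budgets)

Support file (seat `prim-ineq-prove-1` gen 68; `--supports stmt-CriticalPhenomena-4575`).  No `sorry`, no named facts; one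
definition (`EdgeLemma`, conjecture-shaped, used only as a hypothesis).  Memo:
run/shared/lean/prim/prim-ineq-prove-1/FINDING-EDGE-prove1-g68.md §4.

THE OBSERVATION.  Let `A = A₀ ∪ {a,b open} ∪ {a,c open} ∪ {b,d open}` with `A₀` not depending on `a, b` (for the cycle `C_n`:
`a, b` adjacent, `c, d` their other neighbours, `A₀` the core of the path `C_n − a − b`, of which `c` and `d` are the two ends).
Condition a petal `W ⊇ A` on the block `{a, b}`: the section with both present is EVERYTHING (`{a,b open} ⊆ A`), the section
`x` (`a` present, `b` missing) contains `P_L := A₀ ∪ {c open}`, the section `y` (`b` present, `a` missing) contains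
`P_R := A₀ ∪ {d open}`, the section `z` (both missing) contains `A₀`, and `z ≤ min(x, y)`.  Two petals meet inside `A` iff their
`x`-sections meet in `P_L`, their `y`-sections in `P_R`, their `z`-sections in `A₀` — the incomparable pair (`x` of one, `y` of the
other) meets in the `11`-section, which is everything: NO CONSTRAINT.  The comparable pairs (`z` of one, `x` of another) meet in
`P_L`: this is a TWO-LEVEL configuration for the pair `(A₀, A₀ ∪ {c open})` — the two-level Lemma A at a leaf when `c` is a leaf of
the graph of `A₀` (`…SunflowerTwoLevelPendant`).  Hence Lemma A for `A` follows from the cell inequality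
* `EdgeLemma p r g₀ g_L g_R`: petals `(x_k, y_k, z_k)` with `g_L ≤ x ≤ 1`, `g_R ≤ y ≤ 1`, `g₀ ≤ z ≤ min(x,y)`; budgets (all
  sub-families): `∏x ≤ g_L^(k−1)`, `∏y ≤ g_R^(k−1)`, `∏z ≤ g₀^(k−1)` (safety of `P_L`, `P_R`, `A₀`), the two-level budgets
  `∏_S z·∏_{S'} x ≤ g₀^(|S|−1) g_L^|S'|`, `∏_S z·∏_{S'} y ≤ g₀^(|S|−1) g_R^|S'|` (`S ≠ ∅`, `S ∩ S' = ∅`), and the merged budgets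
  `∏(p·x + (1−p)z) ≤ (p·g_L + (1−p)g₀)^(k−1)`, `∏(r·y + (1−r)z) ≤ (r·g_R + (1−r)g₀)^(k−1)` (safety of `A₀ ∪ {a,c open}`,
  `A₀ ∪ {b,d open}`) ⟹ `∏_k (pr + p(1−r)x_k + (1−p)r·y_k + (1−p)(1−r)z_k) ≤ (pr + p(1−r)g_L + (1−p)r·g_R + (1−p)(1−r)g₀)^(n−1)`.
  It has the shape of `TBern` (`(x,y,z) ~ (u,vv,m)`, `(p,r) ~ (t,s)`) with a LOWER floor for `z`; numerically exact (memo §4); OPEN.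
* **`safe_of_edgeLemma`** (fixed `p`): the safeties above, `TwoLevelLemmaA p A₀ (A₀ ∪ {c open})`, `TwoLevelLemmaA p A₀ (A₀ ∪ {d open})`
  and `EdgeLemma (p a) (p b) μ(A₀) μ(P_L) μ(P_R)` ⟹ `Safe p (A₀ ∪ {a,b open} ∪ {a,c open} ∪ {b,d open})`.
With `…SunflowerTwoLevelPendant` this reduces "every cycle has an A-safe core" to the two analytic inequalities `GradedTBern` and
`EdgeLemma` (memo §5).
-/

noncomputable section

namespace Summit.CriticalPhenomena.PercolationContinuityZ3.Theorems.SunflowerPartition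

namespace SafeCalc

open MeasureTheory Finset
open Literature.Probability.LatticeModels Literature.Probability.Percolation

namespace LinkedCurrency

/-- **The edge cell inequality `EdgeLemma p r g₀ gL gR` (statement).**  See the module docstring: petals `(x_k, y_k, z_k)`,
floors `gL ≤ x ≤ 1`, `gR ≤ y ≤ 1`, `g₀ ≤ z ≤ min(x, y)`, single-level budgets on every sub-family, the two two-level budgets,
the two merged budgets; conclusion `∏_k (pr + p(1−r)x_k + (1−p)r·y_k + (1−p)(1−r)z_k) ≤ F^(n−1)`.
[conjecture-shaped hypothesis, this work] -/
def EdgeLemma (p r g₀ gL gR : ℝ) : Prop :=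
  ∀ (n : ℕ) (x y z : Fin n → ℝ),
    (∀ k, gL ≤ x k) → (∀ k, x k ≤ 1) → (∀ k, gR ≤ y k) → (∀ k, y k ≤ 1) → (∀ k, g₀ ≤ z k) →
    (∀ k, z k ≤ x k) → (∀ k, z k ≤ y k) →
    (∀ S : Finset (Fin n), ∏ k ∈ S, x k ≤ gL ^ (S.card - 1)) →
    (∀ S : Finset (Fin n), ∏ k ∈ S, y k ≤ gR ^ (S.card - 1)) →
    (∀ S : Finset (Fin n), ∏ k ∈ S, z k ≤ g₀ ^ (S.card - 1)) →
    (∀ S S' : Finset (Fin n), Disjoint S S' → S.Nonempty →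
      (∏ k ∈ S, z k) * ∏ k ∈ S', x k ≤ g₀ ^ (S.card - 1) * gL ^ S'.card) →
    (∀ S S' : Finset (Fin n), Disjoint S S' → S.Nonempty →
      (∏ k ∈ S, z k) * ∏ k ∈ S', y k ≤ g₀ ^ (S.card - 1) * gR ^ S'.card) →
    (∀ S : Finset (Fin n), ∏ k ∈ S, (p * x k + (1 - p) * z k) ≤ (p * gL + (1 - p) * g₀) ^ (S.card - 1)) →
    (∀ S : Finset (Fin n), ∏ k ∈ S, (r * y k + (1 - r) * z k) ≤ (r * gR + (1 - r) * g₀) ^ (S.card - 1)) →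
    ∏ k, (p * r + p * (1 - r) * x k + (1 - p) * r * y k + (1 - p) * (1 - r) * z k) ≤
      (p * r + p * (1 - r) * gL + (1 - p) * r * gR + (1 - p) * (1 - r) * g₀) ^ (n - 1)

end LinkedCurrency

namespace EdgeDecomp

open UnionEdge Pendant LinkedCurrency

variable {ι : Type*} [DecidableEq ι] (p : ι → unitInterval)

/-- Sections along the block `{a, b}` of `{a, c open}` (`c` off the block): `{c open}` when `a` is present, nothing when `a` is
missing. [this work] -/
theorem sect_pair_pairOpen_left {a b c : ι} (hca : c ≠ a) (hcb : c ≠ b) (T : Finset ι) :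
    sect ({a, b} : Finset ι) T (pairOpen a c) = (if a ∈ T then ∅ else {ω : Set ι | c ∈ ω}) := by
  ext ω
  simp only [sect, pairOpen, Set.mem_setOf_eq, Set.mem_union, Set.mem_sdiff, Finset.coe_sdiff, Finset.coe_insert,
    Finset.coe_singleton, Set.mem_insert_iff, Set.mem_singleton_iff, true_or, not_true_eq_false, and_false, false_or,
    true_and, hca, hcb, or_self, not_false_eq_true, and_true, Finset.mem_coe]
  split_ifs with h <;> simp [h]

/-- Sections along the block `{a, b}` of `{b, d open}` (`d` off the block). [this work] -/
theorem sect_pair_pairOpen_right {a b d : ι} (hda : d ≠ a) (hdb : d ≠ b) (T : Finset ι) :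
    sect ({a, b} : Finset ι) T (pairOpen b d) = (if b ∈ T then ∅ else {ω : Set ι | d ∈ ω}) := by
  rw [Finset.pair_comm]; exact sect_pair_pairOpen_left hdb hda T

set_option maxHeartbeats 800000 in
/-- **LEMMA A FROM THE EDGE CELL INEQUALITY (fixed `p`).**  `a, b, c, d` pairwise distinct, `A₀` an up-set not depending on
`a, b`; `P_L = A₀ ∪ {c open}`, `P_R = A₀ ∪ {d open}`.  If `A₀`, `P_L`, `P_R`, `A₀ ∪ {a,c open}`, `A₀ ∪ {b,d open}` are safe at `p`,
`TwoLevelLemmaA p A₀ P_L` and `TwoLevelLemmaA p A₀ P_R` hold, and `EdgeLemma (p a) (p b) μ(A₀) μ(P_L) μ(P_R)`, then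
`A₀ ∪ {a,b open} ∪ {a,c open} ∪ {b,d open}` is safe at `p`. [this work] -/
theorem safe_of_edgeLemma [Fintype ι] {a b c d : ι} (hab : a ≠ b) (hca : c ≠ a) (hcb : c ≠ b) (hda : d ≠ a) (hdb : d ≠ b)
    {A₀ : Set (Set ι)} (hd : DeterminedBy A₀ (↑({a, b} : Finset ι) : Set ι)ᶜ) (hu : IsUpperSet A₀)
    (hS0 : Safe p A₀) (hSL : Safe p (A₀ ∪ {ω | c ∈ ω})) (hSR : Safe p (A₀ ∪ {ω | d ∈ ω}))
    (hSX : Safe p (A₀ ∪ pairOpen a c)) (hSY : Safe p (A₀ ∪ pairOpen b d))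
    (hTL : TwoLevelLemmaA p A₀ (A₀ ∪ {ω | c ∈ ω})) (hTR : TwoLevelLemmaA p A₀ (A₀ ∪ {ω | d ∈ ω}))
    (hE : EdgeLemma (p a : ℝ) (p b : ℝ) ((prodBernoulli p).real A₀) ((prodBernoulli p).real (A₀ ∪ {ω | c ∈ ω}))
      ((prodBernoulli p).real (A₀ ∪ {ω | d ∈ ω}))) :
    Safe p (A₀ ∪ pairOpen a b ∪ pairOpen a c ∪ pairOpen b d) := by
  classical
  intro n V hV hcap
  set bk : Finset ι := {a, b} with hbk
  set A : Set (Set ι) := A₀ ∪ pairOpen a b ∪ pairOpen a c ∪ pairOpen b d with hAdef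
  set PL : Set (Set ι) := A₀ ∪ {ω | c ∈ ω} with hPL
  set PR : Set (Set ι) := A₀ ∪ {ω | d ∈ ω} with hPR
  have hcup : IsUpperSet {ω : Set ι | c ∈ ω} := fun _ _ hle h => hle h
  have hdup : IsUpperSet {ω : Set ι | d ∈ ω} := fun _ _ hle h => hle h
  have hAup : IsUpperSet A :=
    ((hu.union (isUpperSet_pairOpen a b)).union (isUpperSet_pairOpen a c)).union (isUpperSet_pairOpen b d)
  -- enlarge the petals so that they contain the core
  set W : Fin n → Set (Set ι) := fun i => V i ∪ A with hW
  have hWup : ∀ i, IsUpperSet (W i) := fun i => (hV i).union hAup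
  have hWA : ∀ i, A ⊆ W i := fun i => Set.subset_union_right
  have hWcap : ∀ i j, i ≠ j → W i ∩ W j ⊆ A := by
    intro i j hij ω hω
    rcases hω with ⟨h1 | h1, h2 | h2⟩
    · exact hcap i j hij ⟨h1, h2⟩
    exacts [h2, h1, h1]
  have hmono : ∀ i, (prodBernoulli p).real (V i) ≤ (prodBernoulli p).real (W i) :=
    fun i => measureReal_mono Set.subset_union_left
  -- sections of the core along the block `{a, b}`
  obtain ⟨e0, eb, ea, eab⟩ := sect_pairOpen hab
  have hd' : ∀ T : Finset ι, sect bk T A₀ = A₀ := fun T => sect_eq_self_of_determinedBy_compl bk T hd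
  have hb_ne_a : b ≠ a := hab.symm
  have hA0 : sect bk ∅ A = Set.univ := by
    rw [hAdef, sect_union, sect_union, sect_union, e0]; simp
  have hAb : sect bk {b} A = PL := by
    rw [hAdef, sect_union, sect_union, sect_union, hd', eb, sect_pair_pairOpen_left hca hcb, sect_pair_pairOpen_right hda hdb]
    simp [hab, hPL]
  have hAa : sect bk {a} A = PR := by
    rw [hAdef, sect_union, sect_union, sect_union, hd', ea, sect_pair_pairOpen_left hca hcb, sect_pair_pairOpen_right hda hdb]
    simp [hb_ne_a, hPR]
  have hAab : sect bk {a, b} A = A₀ := by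
    rw [hAdef, sect_union, sect_union, sect_union, hd', eab, sect_pair_pairOpen_left hca hcb, sect_pair_pairOpen_right hda hdb]
    simp
  -- the `b`-missing merged section (block `{b}`) and the `a`-missing merged section (block `{a}`) of the core
  have hdb' : DeterminedBy A₀ (↑({b} : Finset ι) : Set ι)ᶜ :=
    hd.mono (Set.compl_subset_compl.2 (by simp [hbk]))
  have hda' : DeterminedBy A₀ (↑({a} : Finset ι) : Set ι)ᶜ :=
    hd.mono (Set.compl_subset_compl.2 (by simp [hbk]))
  have hdac : DeterminedBy (pairOpen a c) (↑({b} : Finset ι) : Set ι)ᶜ :=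
    (determinedBy_pairOpen a c).mono (by
      intro x hx
      simp only [Finset.coe_insert, Finset.coe_singleton, Set.mem_insert_iff, Set.mem_singleton_iff] at hx
      simp only [Set.mem_compl_iff, Finset.coe_singleton, Set.mem_singleton_iff]
      rcases hx with rfl | rfl
      · exact hab
      · exact hcb)
  have hdbd : DeterminedBy (pairOpen b d) (↑({a} : Finset ι) : Set ι)ᶜ :=
    (determinedBy_pairOpen b d).mono (by
      intro x hx
      simp only [Finset.coe_insert, Finset.coe_singleton, Set.mem_insert_iff, Set.mem_singleton_iff] at hx
      simp only [Set.mem_compl_iff, Finset.coe_singleton, Set.mem_singleton_iff]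
      rcases hx with rfl | rfl
      · exact hb_ne_a
      · exact hda)
  have hAbb : sect ({b} : Finset ι) {b} A = A₀ ∪ pairOpen a c := by
    rw [hAdef, sect_union, sect_union, sect_union, sect_eq_self_of_determinedBy_compl {b} {b} hdb', sect_z_pairOpen a b,
      sect_eq_self_of_determinedBy_compl {b} {b} hdac, RelLemmaA.pairOpen_comm b d, sect_z_pairOpen d b]
    simp
  have hAaa : sect ({a} : Finset ι) {a} A = A₀ ∪ pairOpen b d := by
    rw [hAdef, sect_union, sect_union, sect_union, sect_eq_self_of_determinedBy_compl {a} {a} hda', RelLemmaA.pairOpen_comm a b,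
      sect_z_pairOpen b a, RelLemmaA.pairOpen_comm a c, sect_z_pairOpen c a, sect_eq_self_of_determinedBy_compl {a} {a} hdbd]
    simp
  -- coins and floors
  set pa : ℝ := ((p a : unitInterval) : ℝ) with hpa
  set r : ℝ := ((p b : unitInterval) : ℝ) with hr
  set g₀ : ℝ := (prodBernoulli p).real A₀ with hg₀
  set gL : ℝ := (prodBernoulli p).real PL with hgL
  set gR : ℝ := (prodBernoulli p).real PR with hgR
  have hp0 : 0 ≤ pa := (p a).2.1
  have hp1 : pa ≤ 1 := (p a).2.2
  have hr0 : 0 ≤ r := (p b).2.1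
  have hr1 : r ≤ 1 := (p b).2.2
  have hp' : 0 ≤ 1 - pa := sub_nonneg.2 hp1
  have hr' : 0 ≤ 1 - r := sub_nonneg.2 hr1
  -- measures of the core and of the two merged cores
  have hAval : (prodBernoulli p).real A = pa * r + pa * (1 - r) * gL + (1 - pa) * r * gR + (1 - pa) * (1 - r) * g₀ := by
    rw [real_eq_BEx p bk A, BEx_pair p hab, hA0, hAb, hAa, hAab, probReal_univ]; ring
  have hdisj : Disjoint ({a} : Finset ι) {b} := by
    rw [Finset.disjoint_singleton_left, Finset.mem_singleton]; exact hab
  have hab_eq : ({a} : Finset ι) ∪ {b} = bk := by rw [hbk, Finset.insert_eq]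
  have hba_eq : ({b} : Finset ι) ∪ {a} = bk := by rw [Finset.union_comm, hab_eq]
  have hXval : ∀ S : Set (Set ι), (prodBernoulli p).real (sect ({b} : Finset ι) {b} S) =
      pa * (prodBernoulli p).real (sect bk {b} S) + (1 - pa) * (prodBernoulli p).real (sect bk {a, b} S) := by
    intro S
    rw [real_eq_BEx p {a} (sect {b} {b} S), BEx_singleton, sect_sect hdisj (Finset.empty_subset _) subset_rfl,
      sect_sect hdisj subset_rfl subset_rfl, Finset.empty_union, hab_eq]
  have hYval : ∀ S : Set (Set ι), (prodBernoulli p).real (sect ({a} : Finset ι) {a} S) =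
      r * (prodBernoulli p).real (sect bk {a} S) + (1 - r) * (prodBernoulli p).real (sect bk {a, b} S) := by
    intro S
    rw [real_eq_BEx p {b} (sect {a} {a} S), BEx_singleton, sect_sect hdisj.symm (Finset.empty_subset _) subset_rfl,
      sect_sect hdisj.symm subset_rfl subset_rfl, Finset.empty_union, hba_eq]
  have hXcore : (prodBernoulli p).real (A₀ ∪ pairOpen a c) = pa * gL + (1 - pa) * g₀ := by
    rw [← hAbb, hXval A, hAb, hAab]
  have hYcore : (prodBernoulli p).real (A₀ ∪ pairOpen b d) = r * gR + (1 - r) * g₀ := by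
    rw [← hAaa, hYval A, hAa, hAab]
  -- section measures of the petals
  set x : Fin n → ℝ := fun k => (prodBernoulli p).real (sect bk {b} (W k)) with hxd
  set y : Fin n → ℝ := fun k => (prodBernoulli p).real (sect bk {a} (W k)) with hyd
  set z : Fin n → ℝ := fun k => (prodBernoulli p).real (sect bk {a, b} (W k)) with hzd
  have hWle : ∀ k, (prodBernoulli p).real (W k) ≤
      pa * r + pa * (1 - r) * x k + (1 - pa) * r * y k + (1 - pa) * (1 - r) * z k := by
    intro k
    rw [real_eq_BEx p bk (W k), BEx_pair p hab]
    have h1 : (prodBernoulli p).real (sect bk ∅ (W k)) ≤ 1 := measureReal_le_one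
    have := mul_le_mul_of_nonneg_left h1 (mul_nonneg hp0 hr0)
    simp only [hxd, hyd, hzd]
    linarith
  have hxL : ∀ k, gL ≤ x k := fun k => by
    have h := sect_mono bk {b} (hWA k); rw [hAb] at h; exact measureReal_mono h
  have hyR : ∀ k, gR ≤ y k := fun k => by
    have h := sect_mono bk {a} (hWA k); rw [hAa] at h; exact measureReal_mono h
  have hz0 : ∀ k, g₀ ≤ z k := fun k => by
    have h := sect_mono bk {a, b} (hWA k); rw [hAab] at h; exact measureReal_mono h
  have hx1 : ∀ k, x k ≤ 1 := fun k => measureReal_le_one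
  have hy1 : ∀ k, y k ≤ 1 := fun k => measureReal_le_one
  have hzx : ∀ k, z k ≤ x k := fun k =>
    measureReal_mono (sect_anti bk (show ({b} : Finset ι) ⊆ {a, b} by simp) (hWup k))
  have hzy : ∀ k, z k ≤ y k := fun k =>
    measureReal_mono (sect_anti bk (show ({a} : Finset ι) ⊆ {a, b} by simp) (hWup k))
  -- single-level budgets on sub-families
  have hcapT : ∀ (T : Finset ι) (i j : Fin n), i ≠ j → sect bk T (W i) ∩ sect bk T (W j) ⊆ sect bk T A := by
    intro T i j hij; rw [← sect_inter]; exact sect_mono bk T (hWcap i j hij)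
  have hBX : ∀ S : Finset (Fin n), ∏ k ∈ S, x k ≤ gL ^ (S.card - 1) := by
    intro S
    have h1 := hSL.prod_le (κ := S) (V := fun k : S => sect bk {b} (W k)) (fun k => isUpperSet_sect bk _ (hWup k))
      (fun i j hij => (hcapT {b} i j fun h => hij (Subtype.ext h)).trans hAb.subset)
    rw [Fintype.card_coe] at h1; rw [← prod_coe_sort S]; exact h1
  have hBY : ∀ S : Finset (Fin n), ∏ k ∈ S, y k ≤ gR ^ (S.card - 1) := by
    intro S
    have h1 := hSR.prod_le (κ := S) (V := fun k : S => sect bk {a} (W k)) (fun k => isUpperSet_sect bk _ (hWup k))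
      (fun i j hij => (hcapT {a} i j fun h => hij (Subtype.ext h)).trans hAa.subset)
    rw [Fintype.card_coe] at h1; rw [← prod_coe_sort S]; exact h1
  have hBZ : ∀ S : Finset (Fin n), ∏ k ∈ S, z k ≤ g₀ ^ (S.card - 1) := by
    intro S
    have h1 := hS0.prod_le (κ := S) (V := fun k : S => sect bk {a, b} (W k)) (fun k => isUpperSet_sect bk _ (hWup k))
      (fun i j hij => (hcapT {a, b} i j fun h => hij (Subtype.ext h)).trans hAab.subset)
    rw [Fintype.card_coe] at h1; rw [← prod_coe_sort S]; exact h1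
  -- two-level budgets
  have hBZX : ∀ S S' : Finset (Fin n), Disjoint S S' → S.Nonempty →
      (∏ k ∈ S, z k) * ∏ k ∈ S', x k ≤ g₀ ^ (S.card - 1) * gL ^ S'.card := by
    intro S S' hSS hS
    refine hTL n (fun k => sect bk {a, b} (W k)) (fun k => sect bk {b} (W k)) S S' hS hSS
      (fun k _ => isUpperSet_sect bk _ (hWup k)) (fun k _ => by rw [← hAab]; exact sect_mono bk {a, b} (hWA k))
      (fun k _ => isUpperSet_sect bk _ (hWup k)) (fun k _ => by rw [← hAb]; exact sect_mono bk {b} (hWA k))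
      (fun i _ j _ hij => by rw [← hAab]; exact hcapT {a, b} i j hij)
      (fun i _ j _ hij => by rw [← hAb]; exact hcapT {b} i j hij) ?_
    intro j hj i hi
    have hji : j ≠ i := fun h => disjoint_left.1 hSS hj (h ▸ hi)
    rw [← hAb]
    exact (Set.inter_subset_inter_left _ (sect_anti bk (show ({b} : Finset ι) ⊆ {a, b} by simp) (hWup j))).trans
      (hcapT {b} j i hji)
  have hBZY : ∀ S S' : Finset (Fin n), Disjoint S S' → S.Nonempty →
      (∏ k ∈ S, z k) * ∏ k ∈ S', y k ≤ g₀ ^ (S.card - 1) * gR ^ S'.card := by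
    intro S S' hSS hS
    refine hTR n (fun k => sect bk {a, b} (W k)) (fun k => sect bk {a} (W k)) S S' hS hSS
      (fun k _ => isUpperSet_sect bk _ (hWup k)) (fun k _ => by rw [← hAab]; exact sect_mono bk {a, b} (hWA k))
      (fun k _ => isUpperSet_sect bk _ (hWup k)) (fun k _ => by rw [← hAa]; exact sect_mono bk {a} (hWA k))
      (fun i _ j _ hij => by rw [← hAab]; exact hcapT {a, b} i j hij)
      (fun i _ j _ hij => by rw [← hAa]; exact hcapT {a} i j hij) ?_
    intro j hj i hi
    have hji : j ≠ i := fun h => disjoint_left.1 hSS hj (h ▸ hi)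
    rw [← hAa]
    exact (Set.inter_subset_inter_left _ (sect_anti bk (show ({a} : Finset ι) ⊆ {a, b} by simp) (hWup j))).trans
      (hcapT {a} j i hji)
  -- merged budgets
  have hBMX : ∀ S : Finset (Fin n), ∏ k ∈ S, (pa * x k + (1 - pa) * z k) ≤ (pa * gL + (1 - pa) * g₀) ^ (S.card - 1) := by
    intro S
    have h1 := hSX.prod_le (κ := S) (V := fun k : S => sect ({b} : Finset ι) {b} (W k))
      (fun k => isUpperSet_sect {b} _ (hWup k))
      (fun i j hij => by rw [← hAbb, ← sect_inter]; exact sect_mono {b} {b} (hWcap i j fun h => hij (Subtype.ext h)))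
    rw [Fintype.card_coe, hXcore] at h1
    rw [← prod_coe_sort S]
    refine le_of_eq_of_le (Fintype.prod_congr _ _ fun k => ?_) h1
    exact (hXval (W k)).symm
  have hBMY : ∀ S : Finset (Fin n), ∏ k ∈ S, (r * y k + (1 - r) * z k) ≤ (r * gR + (1 - r) * g₀) ^ (S.card - 1) := by
    intro S
    have h1 := hSY.prod_le (κ := S) (V := fun k : S => sect ({a} : Finset ι) {a} (W k))
      (fun k => isUpperSet_sect {a} _ (hWup k))
      (fun i j hij => by rw [← hAaa, ← sect_inter]; exact sect_mono {a} {a} (hWcap i j fun h => hij (Subtype.ext h)))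
    rw [Fintype.card_coe, hYcore] at h1
    rw [← prod_coe_sort S]
    refine le_of_eq_of_le (Fintype.prod_congr _ _ fun k => ?_) h1
    exact (hYval (W k)).symm
  -- assemble
  have key := hE n x y z hxL hx1 hyR hy1 hz0 hzx hzy hBX hBY hBZ hBZX hBZY hBMX hBMY
  rw [hAval]
  refine le_trans (prod_le_prod (fun i _ => measureReal_nonneg) fun i _ => hmono i) ?_
  exact le_trans (prod_le_prod (fun i _ => measureReal_nonneg) fun i _ => hWle i) key

end EdgeDecomp

end SafeCalc

end Summit.CriticalPhenomena.PercolationContinuityZ3.Theorems.SunflowerPartition
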